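import Summits.CriticalPhenomena.PercolationContinuityZ3.Theorems.PercAnnulusCrossingIICBottlenecksArmConditioned
import Summits.CriticalPhenomena.PercolationContinuityZ3.Theorems.PercAnnulusCrossingIICResistanceNashWilliams
import Summits.CriticalPhenomena.PercolationContinuityZ3.Theorems.PercAnnulusCrossingIICBottlenecksCount
import HarnessLib

/-!
# Bottlenecks of the arm, X: given the arm to distance `N`, the resistance from the root to `∂Λ(N)` exceeds `(log_L N)/2` with probability `≥ 1 − 2^{−j}` (lane RSW3, p1 gen 27)

builds on p205010 (kernel theorem, internal audit signed; external expert review pending) — NOT used in this file (finite volume; every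
`d ≥ 1`, every `p > 0` satisfying UAD at the chosen aspect; no IIC limit).

RSW3 lane (LANE 3 `prim-rsw3`), seat `prim-rsw3-p1` (gen 27).  Helper file (`--supports stmt-CriticalPhenomena-4575`); no definitions,
no sorries.  Memo `run/shared/lean/prim/rsw3/P1-QM.md` §40.6.  The census form of `…IICResistanceGrowth`:

`…IICBottlenecksArmConditioned`: under UAD at `ε = 1/8` (`L = 2K₀+3`), for `N > L^{2j}`,
`P_p(#{i < 2j : annulus i has an open bond pivotal for A_N} ≤ j | A_N) ≤ 2^{−j}`; `…IICResistanceNashWilliams.ncard_pivotal_le_energy`: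
every unit flow from the root, divergence-free on `Λ(N−1) ∖ {0}`, has energy `≥ #{open pairs of Λ(N−1) pivotal for A_N}`.  Distinct annuli
below `L^{2j} ≤ N − 1` give distinct pivotal pairs of `Λ(N−1)`, so:

* `ncard_pivotalAnnuli_le_ncard_pivotal` — deterministic: the number of annuli `i < 2j` with an open pivotal bond is at most the number of
  pivotal open pairs of `Λ(N−1)` (an injection, `disjoint_annulusPairs`);
* **`real_siteToBoundary_inter_exists_lowEnergyFlow_le_of_uad`** — **`P_p(A_N ∩ {∃ unit flow from the root, div-free on Λ(N−1) ∖ {0}, on the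
  open edges, with energy ≤ j}) ≤ 2^{−j}·π_p(N)`** for every `j` and `N > L^{2j}`: GIVEN THE ARM TO DISTANCE `N`, THE RESISTANCE BETWEEN THE
  ROOT AND `∂Λ(N)` IN THE OPEN CLUSTER IS `> (log_L N)/2` EXCEPT WITH CONDITIONAL PROBABILITY `2^{−⌊(log_L N)/2⌋}` (census observable:
  resistance by a linear solve on arm-conditioned samples); `…_div_oneArmProb_le_of_uad` — conditional form.
References: C. Nash-Williams (1959); R. Lyons, Y. Peres (2016) (2.14); M. Heydenreich, R. van der Hofstad (2017) §14.3 Exerc. 14.5;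
H. Kesten, AIHP 22 (1986).
-/

noncomputable section

namespace Summit.CriticalPhenomena.PercolationContinuityZ3.Theorems.Crossing

open MeasureTheory Filter Topology Literature.Probability.Percolation Literature.Probability.LatticeModels
open Literature.Probability.Percolation.DCT16
open Summit.CriticalPhenomena.PercolationContinuityZ3.Theorems.SurfaceTension
open scoped Literature.Probability.Percolation ENNReal

variable {d : ℕ}

/-- **DISTINCT ANNULI GIVE DISTINCT PIVOTAL PAIRS** (deterministic): for the `L`-adic annuli `D_i = (Λ(L^{i+1}) ∖ Λ(L^i)).sym2`, `i < 2j`,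
`L ≥ 1`, `L^{2j} ≤ M`: the number of `i < 2j` such that `D_i` contains an open pair `e` with `ω ∖ {e} ∉ A_N` is at most
`#{e ∈ Λ(M).sym2 : ω ∖ {e} ∉ A_N}`. [folklore] -/
theorem ncard_pivotalAnnuli_le_ncard_pivotal {L j M N : ℕ} (hL : 1 ≤ L) (hM : L ^ (2 * j) ≤ M) (ω : BondConfig (Site d)) :
    {i : ℕ | i < 2 * j ∧ ∃ e ∈ (((↑(box d (L ^ (i + 1))) : Set (Site d)) \ ↑(box d (L ^ i))).sym2),
        e ∈ ω ∧ ω \ {e} ∉ siteToBoundary d N}.ncard ≤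
      {e : Sym2 (Site d) | e ∈ (↑((box d M).sym2) : Set (Sym2 (Site d))) ∧ ω \ {e} ∉ siteToBoundary d N}.ncard := by
  classical
  set G : Set ℕ := {i : ℕ | i < 2 * j ∧ ∃ e ∈ (((↑(box d (L ^ (i + 1))) : Set (Site d)) \ ↑(box d (L ^ i))).sym2),
      e ∈ ω ∧ ω \ {e} ∉ siteToBoundary d N} with hG
  have hchoice : ∀ i : ℕ, ∃ e : Sym2 (Site d), (i ∈ G →
      e ∈ (((↑(box d (L ^ (i + 1))) : Set (Site d)) \ ↑(box d (L ^ i))).sym2) ∧ e ∈ ω ∧ ω \ {e} ∉ siteToBoundary d N) := by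
    intro i
    by_cases hi : i ∈ G
    · obtain ⟨-, e, he, heω, hcut⟩ := hi
      exact ⟨e, fun _ => ⟨he, heω, hcut⟩⟩
    · exact ⟨s(0, 0), fun h => absurd h hi⟩
  choose f hf using hchoice
  have hsep : ∀ i i' : ℕ, i < i' → L ^ (i + 1) ≤ L ^ i' := fun i i' h => Nat.pow_le_pow_right hL h
  refine Set.ncard_le_ncard_of_injOn f (fun i hi => ?_) (fun i hi i' hi' hii' => ?_)
    (Set.Finite.subset (box d M).sym2.finite_toSet fun e he => he.1)
  · obtain ⟨he, -, hcut⟩ := hf i hi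
    refine ⟨?_, hcut⟩
    have hi2 : i < 2 * j := hi.1
    exact (annulusPairs_pow_subset_sym2_box hL hi2).trans (Finset.coe_subset.2 (Finset.sym2_mono (box_mono d hM))) he
  · by_contra hne
    rcases Nat.lt_or_gt_of_ne hne with hlt | hlt
    · exact Set.disjoint_left.1 (disjoint_annulusPairs (d := d) (hsep i i' hlt)) (hf i hi).1 (hii' ▸ (hf i' hi').1)
    · exact Set.disjoint_left.1 (disjoint_annulusPairs (d := d) (hsep i' i hlt)) (hf i' hi').1 (hii'.symm ▸ (hf i hi).1)

/-- **GIVEN THE ARM, LOW RESISTANCE IS EXPONENTIALLY UNLIKELY** (every `d ≥ 1`, `0 < p`, UAD at `ε = 1/8` with constant `K₀`; `L = 2K₀+3`):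
for every `j` and every `N > L^{2j}`:
**`P_p(A_N ∩ {∃ f antisymmetric on the open edges, div-free on Λ(N−1) ∖ {0}, unit out-flow at 0, Σ f² < ∞, Σ f² ≤ j}) ≤ 2^{−j}·π_p(N)`** —
on the complement of the `…IICBottlenecksArmConditioned` event more than `j` annuli carry an open pivotal bond, which are distinct pivotal
open pairs of `Λ(N−1)`, and Nash-Williams (`ncard_pivotal_le_energy`) makes every such flow have energy `> j`.
[cite: HeydenreichVanDerHofstad2017, §14.3 Exerc. 14.5] [cite: LyonsPeres2016, (2.14)] -/
theorem real_siteToBoundary_inter_exists_lowEnergyFlow_le_of_uad (hd : 1 ≤ d) (p : unitInterval) (hp : 0 < (p : ℝ)) {K₀ : ℕ}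
    (hK₀ : ∀ m : ℕ, 1 ≤ m → ∀ N : ℕ, K₀ * m ≤ N → (bondPercolation (zdGraph d) p).real (boxCrossing d m N) ≤ 1 / 8)
    (j : ℕ) {N : ℕ} (hN : (2 * K₀ + 3) ^ (2 * j) < N) :
    (bondPercolation (zdGraph d) p).real (siteToBoundary d N ∩ {ω : BondConfig (Site d) | ∃ f : Site d → Site d → ℝ,
        (∀ x y, f x y = -f y x) ∧ (∀ x y, f x y ≠ 0 → (zdGraph d).Adj x y ∧ s(x, y) ∈ ω) ∧
        (∀ x ∈ box d (N - 1), x ≠ 0 → ∑ y ∈ (zdGraph d).neighborFinset x, f x y = 0) ∧ ∑ y ∈ (zdGraph d).neighborFinset 0, f 0 y = 1 ∧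
        Summable (fun q : Site d × Site d => f q.1 q.2 ^ 2) ∧ ∑' q : Site d × Site d, f q.1 q.2 ^ 2 ≤ j}) ≤
      (1 / 2 : ℝ) ^ j * oneArmProb d p N := by
  set L : ℕ := 2 * K₀ + 3 with hL
  have hL1 : 1 ≤ L := by omega
  have hNpos : 1 ≤ N := by omega
  have hN' : N - 1 + 1 = N := by omega
  -- inclusion on lattice configurations: a low-energy flow forces few pivotal annuli
  have hfew := real_ncard_pivotalAnnuli_div_oneArmProb_le_of_uad hd p hp hK₀ j hN
  rw [div_le_iff₀ (oneArmProb_pos hd p hp N)] at hfew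
  refine le_trans (real_mono_of_forall_subset_edgeSet (zdGraph d) p fun ω hω h => ?_) hfew
  obtain ⟨hA, f, hanti, hsupp, hdiv, hsrc, hsum, hener⟩ := h
  refine ⟨hA, ?_⟩
  simp only [Set.mem_setOf_eq]
  have h1 := ncard_pivotalAnnuli_le_ncard_pivotal (d := d) (j := j) (N := N) hL1 (M := N - 1) (by omega) ω
  have h2 := ncard_pivotal_le_energy (N := N - 1) hω hanti hsupp hdiv hsrc hsum
  rw [hN'] at h2
  have h3 : (({e : Sym2 (Site d) | e ∈ (↑((box d (N - 1)).sym2) : Set (Sym2 (Site d))) ∧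
      ω \ {e} ∉ siteToBoundary d N}.ncard : ℕ) : ℝ) ≤ j := h2.trans hener
  exact_mod_cast h1.trans (by exact_mod_cast h3)

/-- **CONDITIONAL FORM**: `P_p(resistance from the root to ∂Λ(N) ≤ j | A_N) ≤ 2^{−j}` for `N > L^{2j}` — i.e. given the arm to distance `N`, the
resistance of the open cluster between the root and `∂Λ(N)` exceeds `(log_L N)/2 − 1` except with probability `2·2^{−(log_L N)/2}`.
[cite: HeydenreichVanDerHofstad2017, §14.3 Exerc. 14.5] -/
theorem real_exists_lowEnergyFlow_div_oneArmProb_le_of_uad (hd : 1 ≤ d) (p : unitInterval) (hp : 0 < (p : ℝ)) {K₀ : ℕ}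
    (hK₀ : ∀ m : ℕ, 1 ≤ m → ∀ N : ℕ, K₀ * m ≤ N → (bondPercolation (zdGraph d) p).real (boxCrossing d m N) ≤ 1 / 8)
    (j : ℕ) {N : ℕ} (hN : (2 * K₀ + 3) ^ (2 * j) < N) :
    (bondPercolation (zdGraph d) p).real (siteToBoundary d N ∩ {ω : BondConfig (Site d) | ∃ f : Site d → Site d → ℝ,
        (∀ x y, f x y = -f y x) ∧ (∀ x y, f x y ≠ 0 → (zdGraph d).Adj x y ∧ s(x, y) ∈ ω) ∧
        (∀ x ∈ box d (N - 1), x ≠ 0 → ∑ y ∈ (zdGraph d).neighborFinset x, f x y = 0) ∧ ∑ y ∈ (zdGraph d).neighborFinset 0, f 0 y = 1 ∧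
        Summable (fun q : Site d × Site d => f q.1 q.2 ^ 2) ∧ ∑' q : Site d × Site d, f q.1 q.2 ^ 2 ≤ j}) / oneArmProb d p N ≤
      (1 / 2 : ℝ) ^ j := by
  rw [div_le_iff₀ (oneArmProb_pos hd p hp N)]
  exact real_siteToBoundary_inter_exists_lowEnergyFlow_le_of_uad hd p hp hK₀ j hN

end Summit.CriticalPhenomena.PercolationContinuityZ3.Theorems.Crossing

end
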